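import Summits.KontsevichZagierPeriods.KontsevichZagierPeriods.Theorems.UnfoldedStokesStokesGenerationFibrewiseRungScalingSwaps
import Summits.KontsevichZagierPeriods.KontsevichZagierPeriods.Theorems.UnfoldedStokesStokesGenerationFibrewiseClosureCongr
import Summits.KontsevichZagierPeriods.KontsevichZagierPeriods.Theorems.UnfoldedStokesStokesGenerationFibrewiseClosureMulFresh

/-!
# `StokesGeneration` (stmt-KontsevichZagierPeriods-3586) — line `fibrewise_stokes`, stub `stub_logPairHomotopy`

Registered rung stub G2′ (rung 20, EULER'S REFLECTION RELATOR `Li₂(x) + Li₂(1−x) + log x · log(1−x)` is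
constant modulo `Dec`, wave 4) of the line `fibrewise_stokes` of the crux `StokesGeneration` (route
UnfoldedStokes): the generic LOG-PAIR HOMOTOPY, the two-family generalisation of the log-product homotopy
`stub_logProductHomotopy` (rung 19). On the closed cube `[0,1]³` (`s = x 0`, `t = x 1`, `v = x 2`), for two
abstract one-dimensional parametric integrands `ℓ₁(s,v)`, `ℓ₂(t,v)` with `v`-derivatives `ℓ₁ᵥ`, `ℓ₂ᵥ`
admitting closed-form primitives `μ₁` (in `s`, `∂_s μ₁ = ℓ₁ᵥ`, `μ₁(0,v) = 0`) and `μ₂` (in `t`,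
`∂_t μ₂ = ℓ₂ᵥ`, `μ₂(0,v) = 0`), all `ℚ`-semialgebraic and continuous on the closed square, the function
`μ₁(1,v)ℓ₂(t,v) + ℓ₁(s,v)μ₂(1,v) − (ℓ₁(s,1)ℓ₂(t,1) − ℓ₁(s,0)ℓ₂(t,0))`
is fibrewise-Stokes decomposable (`FibStokesDecomposable 3`, `Theorems/UnfoldedStokesDefs.lean`).

Proof. Three fibrewise Stokes elements on the same cube, no kink sets, no transcendence input:
* along `v` (direction `2`) with primitive `G₀ = ℓ₁(s,v) ℓ₂(t,v)`, fibre derivative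
  `D₀ = ℓ₁ᵥ(s,v)ℓ₂(t,v) + ℓ₁(s,v)ℓ₂ᵥ(t,v)` (product rule) and faces `ℓ₁(s,1)ℓ₂(t,1) − ℓ₁(s,0)ℓ₂(t,0)`;
* along `s` (direction `0`) with primitive `G₁ = −μ₁(s,v) ℓ₂(t,v)`, fibre derivative `D₁ = −ℓ₁ᵥ(s,v)ℓ₂(t,v)`
  and faces `−μ₁(1,v)ℓ₂(t,v) + μ₁(0,v)ℓ₂(t,v) = −μ₁(1,v)ℓ₂(t,v)`;
* along `t` (direction `1`) with primitive `G₂ = −ℓ₁(s,v) μ₂(t,v)`, fibre derivative `D₂ = −ℓ₁(s,v)ℓ₂ᵥ(t,v)`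
  and faces `−ℓ₁(s,v)μ₂(1,v) + ℓ₁(s,v)μ₂(0,v) = −ℓ₁(s,v)μ₂(1,v)`.
The three integrands `Dⱼ − (faces)` are carried by closed-cube representations (`exists_cubeRep`); the family
is decomposable (`fibStokesDecomposable_of_elements`), and its sum equals the displayed function at every
point of the cube (`D₀ + D₁ + D₂ = 0`), so `fibStokesDecomposable_congr_off_null` with the empty null set
concludes. The two-variable data are read on pairs of cube coordinates through `isSemialgebraicFunOn_comp_coord`.

References: D. Zagier, *The dilogarithm function* (2007), §I.2 (Euler's reflection formula
`Li₂(x) + Li₂(1−x) = π²/6 − log x log(1−x)`); M. Kontsevich, D. Zagier, *Periods* (2001), §1.2 (rule (3),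
Newton–Leibniz/Stokes).
-/

noncomputable section

-- `Summit.KontsevichZagierPeriods.KontsevichZagierPeriods.…` is the tree's mandated layout (single-conjunct summit).
set_option linter.dupNamespace false

namespace Summit.KontsevichZagierPeriods.KontsevichZagierPeriods.Cruxes.StokesGeneration.FibrewiseStokes

open MeasureTheory Set
open Literature.NumberTheory.Transcendental
open Literature.NumberTheory.Transcendental.KZ
open Literature.ModelTheory.ExponentialFields (IsSemialgebraic)

/-- Reading a two-variable function of the closed unit square on two coordinates `i, k` of the closed unit
cube preserves `ℚ`-semialgebraicity and continuity. [folklore] -/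
private theorem logPairHomotopy_read {F : ℝ → ℝ → ℝ}
    (hF : IsSemialgebraicFunOn ℚ (Set.pi Set.univ (fun _ : Fin 2 => Set.Icc (0:ℝ) 1)) (fun z => F (z 0) (z 1)))
    (hFc : ContinuousOn (fun z : Fin 2 → ℝ => F (z 0) (z 1)) (Set.pi Set.univ (fun _ : Fin 2 => Set.Icc (0:ℝ) 1)))
    (i k : Fin 3) :
    IsSemialgebraicFunOn ℚ (Set.pi Set.univ (fun _ : Fin 3 => Set.Icc (0:ℝ) 1)) (fun x => F (x i) (x k)) ∧
      ContinuousOn (fun x : Fin 3 → ℝ => F (x i) (x k)) (Set.pi Set.univ (fun _ : Fin 3 => Set.Icc (0:ℝ) 1)) := by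
  have hS : IsSemialgebraic ℚ (Set.pi Set.univ (fun _ : Fin 3 => Set.Icc (0:ℝ) 1)) := by
    rw [← cube_eq_pi]; exact isSemialgebraic_cube
  have hmaps : ∀ x ∈ Set.pi Set.univ (fun _ : Fin 3 => Set.Icc (0:ℝ) 1),
      (fun j => x ((![i, k] : Fin 2 → Fin 3) j)) ∈ Set.pi Set.univ (fun _ : Fin 2 => Set.Icc (0:ℝ) 1) :=
    fun x hx => Set.mem_univ_pi.mpr fun j => (Set.mem_univ_pi.mp hx) _
  refine ⟨?_, ?_⟩
  · exact (isSemialgebraicFunOn_comp_coord hF (![i, k] : Fin 2 → Fin 3)).mono (fun x hx => hmaps x hx) hS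
  · exact hFc.comp (continuous_pi fun j => continuous_apply ((![i, k] : Fin 2 → Fin 3) j)).continuousOn hmaps

/-- **Registered stub `stub_logPairHomotopy` (rung 20, G2′): the generic log-pair homotopy.** On `[0,1]³`
(`s = x 0`, `t = x 1`, `v = x 2`) the three elements `E_v[G = ℓ₁(s,v)ℓ₂(t,v)]`, `E_s[G = −μ₁(s,v)ℓ₂(t,v)]`,
`E_t[G = −ℓ₁(s,v)μ₂(t,v)]` certify
`μ₁(1,v)ℓ₂(t,v) + ℓ₁(s,v)μ₂(1,v) − (ℓ₁ℓ₂|_{v=1} − ℓ₁ℓ₂|_{v=0}) ∈ Dec` for abstract `ℚ`-semialgebraic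
continuous `ℓ₁, ℓ₁ᵥ = ∂_vℓ₁, μ₁ = ∫₀ˢ ℓ₁ᵥ` and `ℓ₂, ℓ₂ᵥ = ∂_vℓ₂, μ₂ = ∫₀ᵗ ℓ₂ᵥ` on the closed square.
[cite: Zagier2007Dilogarithm, §I.2] -/
theorem stub_logPairHomotopy (ℓ₁ ℓ₁ᵥ μ₁ ℓ₂ ℓ₂ᵥ μ₂ : ℝ → ℝ → ℝ)
    (hℓ₁ : IsSemialgebraicFunOn ℚ (Set.pi Set.univ (fun _ : Fin 2 => Set.Icc (0:ℝ) 1)) (fun z => ℓ₁ (z 0) (z 1)))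
    (hℓ₁ᵥ : IsSemialgebraicFunOn ℚ (Set.pi Set.univ (fun _ : Fin 2 => Set.Icc (0:ℝ) 1)) (fun z => ℓ₁ᵥ (z 0) (z 1)))
    (hμ₁ : IsSemialgebraicFunOn ℚ (Set.pi Set.univ (fun _ : Fin 2 => Set.Icc (0:ℝ) 1)) (fun z => μ₁ (z 0) (z 1)))
    (hℓ₂ : IsSemialgebraicFunOn ℚ (Set.pi Set.univ (fun _ : Fin 2 => Set.Icc (0:ℝ) 1)) (fun z => ℓ₂ (z 0) (z 1)))
    (hℓ₂ᵥ : IsSemialgebraicFunOn ℚ (Set.pi Set.univ (fun _ : Fin 2 => Set.Icc (0:ℝ) 1)) (fun z => ℓ₂ᵥ (z 0) (z 1)))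
    (hμ₂ : IsSemialgebraicFunOn ℚ (Set.pi Set.univ (fun _ : Fin 2 => Set.Icc (0:ℝ) 1)) (fun z => μ₂ (z 0) (z 1)))
    (hℓ₁c : ContinuousOn (fun z : Fin 2 → ℝ => ℓ₁ (z 0) (z 1)) (Set.pi Set.univ (fun _ : Fin 2 => Set.Icc (0:ℝ) 1)))
    (hℓ₁ᵥc : ContinuousOn (fun z : Fin 2 → ℝ => ℓ₁ᵥ (z 0) (z 1)) (Set.pi Set.univ (fun _ : Fin 2 => Set.Icc (0:ℝ) 1)))
    (hμ₁c : ContinuousOn (fun z : Fin 2 → ℝ => μ₁ (z 0) (z 1)) (Set.pi Set.univ (fun _ : Fin 2 => Set.Icc (0:ℝ) 1)))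
    (hℓ₂c : ContinuousOn (fun z : Fin 2 → ℝ => ℓ₂ (z 0) (z 1)) (Set.pi Set.univ (fun _ : Fin 2 => Set.Icc (0:ℝ) 1)))
    (hℓ₂ᵥc : ContinuousOn (fun z : Fin 2 → ℝ => ℓ₂ᵥ (z 0) (z 1)) (Set.pi Set.univ (fun _ : Fin 2 => Set.Icc (0:ℝ) 1)))
    (hμ₂c : ContinuousOn (fun z : Fin 2 → ℝ => μ₂ (z 0) (z 1)) (Set.pi Set.univ (fun _ : Fin 2 => Set.Icc (0:ℝ) 1)))
    (hdv₁ : ∀ s ∈ Set.Icc (0:ℝ) 1, ∀ v ∈ Set.Ioo (0:ℝ) 1, HasDerivAt (fun u => ℓ₁ s u) (ℓ₁ᵥ s v) v)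
    (hds₁ : ∀ v ∈ Set.Icc (0:ℝ) 1, ∀ s ∈ Set.Ioo (0:ℝ) 1, HasDerivAt (fun u => μ₁ u v) (ℓ₁ᵥ s v) s)
    (hμ₁0 : ∀ v ∈ Set.Icc (0:ℝ) 1, μ₁ 0 v = 0)
    (hdv₂ : ∀ t ∈ Set.Icc (0:ℝ) 1, ∀ v ∈ Set.Ioo (0:ℝ) 1, HasDerivAt (fun u => ℓ₂ t u) (ℓ₂ᵥ t v) v)
    (hds₂ : ∀ v ∈ Set.Icc (0:ℝ) 1, ∀ t ∈ Set.Ioo (0:ℝ) 1, HasDerivAt (fun u => μ₂ u v) (ℓ₂ᵥ t v) t)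
    (hμ₂0 : ∀ v ∈ Set.Icc (0:ℝ) 1, μ₂ 0 v = 0) :
    FibStokesDecomposable 3 (fun x => μ₁ 1 (x 2) * ℓ₂ (x 1) (x 2) + ℓ₁ (x 0) (x 2) * μ₂ 1 (x 2) -
      (ℓ₁ (x 0) 1 * ℓ₂ (x 1) 1 - ℓ₁ (x 0) 0 * ℓ₂ (x 1) 0)) := by
  classical
  -- the two-variable data read on pairs of cube coordinates: family 1 on `(s, v)`, family 2 on `(t, v)`
  obtain ⟨hA1sa, hA1c⟩ := logPairHomotopy_read hℓ₁ hℓ₁c 0 2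
  obtain ⟨hA2sa, hA2c⟩ := logPairHomotopy_read hℓ₂ hℓ₂c 1 2
  obtain ⟨hV1sa, hV1c⟩ := logPairHomotopy_read hℓ₁ᵥ hℓ₁ᵥc 0 2
  obtain ⟨hV2sa, hV2c⟩ := logPairHomotopy_read hℓ₂ᵥ hℓ₂ᵥc 1 2
  obtain ⟨hM1sa, hM1c⟩ := logPairHomotopy_read hμ₁ hμ₁c 0 2
  obtain ⟨hM2sa, hM2c⟩ := logPairHomotopy_read hμ₂ hμ₂c 1 2
  set C : Set (Fin 3 → ℝ) := Set.pi Set.univ (fun _ : Fin 3 => Set.Icc (0:ℝ) 1) with hC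
  have hCc : IsCompact C := isCompact_univ_pi fun _ => isCompact_Icc
  have hmem : ∀ x ∈ C, ∀ i, x i ∈ Set.Icc (0:ℝ) 1 := fun x hx i => (Set.mem_univ_pi.mp hx) i
  have hupd : ∀ x ∈ C, ∀ (i : Fin 3), ∀ s ∈ Set.Icc (0:ℝ) 1, Function.update x i s ∈ C :=
    fun x hx i s hs => update_mem_cubePi hx i hs
  have h02 : (0 : Fin 3) ≠ 2 := by decide
  have h12 : (1 : Fin 3) ≠ 2 := by decide
  have h10 : (1 : Fin 3) ≠ 0 := by decide
  have h20 : (2 : Fin 3) ≠ 0 := by decide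
  have h01 : (0 : Fin 3) ≠ 1 := by decide
  have h21 : (2 : Fin 3) ≠ 1 := by decide
  have h0I : (0:ℝ) ∈ Set.Icc (0:ℝ) 1 := ⟨le_rfl, zero_le_one⟩
  have h1I : (1:ℝ) ∈ Set.Icc (0:ℝ) 1 := ⟨zero_le_one, le_rfl⟩
  -- the witnesses
  obtain ⟨G0, hG0⟩ : ∃ G0 : (Fin 3 → ℝ) → ℝ, G0 = fun x => ℓ₁ (x 0) (x 2) * ℓ₂ (x 1) (x 2) := ⟨_, rfl⟩
  obtain ⟨D0, hD0⟩ : ∃ D0 : (Fin 3 → ℝ) → ℝ,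
      D0 = fun x => ℓ₁ᵥ (x 0) (x 2) * ℓ₂ (x 1) (x 2) + ℓ₁ (x 0) (x 2) * ℓ₂ᵥ (x 1) (x 2) := ⟨_, rfl⟩
  obtain ⟨G1, hG1⟩ : ∃ G1 : (Fin 3 → ℝ) → ℝ, G1 = fun x => -(μ₁ (x 0) (x 2) * ℓ₂ (x 1) (x 2)) := ⟨_, rfl⟩
  obtain ⟨D1, hD1⟩ : ∃ D1 : (Fin 3 → ℝ) → ℝ, D1 = fun x => -(ℓ₁ᵥ (x 0) (x 2) * ℓ₂ (x 1) (x 2)) := ⟨_, rfl⟩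
  obtain ⟨G2, hG2⟩ : ∃ G2 : (Fin 3 → ℝ) → ℝ, G2 = fun x => -(ℓ₁ (x 0) (x 2) * μ₂ (x 1) (x 2)) := ⟨_, rfl⟩
  obtain ⟨D2, hD2⟩ : ∃ D2 : (Fin 3 → ℝ) → ℝ, D2 = fun x => -(ℓ₁ (x 0) (x 2) * ℓ₂ᵥ (x 1) (x 2)) := ⟨_, rfl⟩
  have hG0sa : IsSemialgebraicFunOn ℚ C G0 := by rw [hG0]; exact hA1sa.fun_mul hA2sa
  have hD0sa : IsSemialgebraicFunOn ℚ C D0 := by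
    rw [hD0]; exact (hV1sa.fun_mul hA2sa).fun_add (hA1sa.fun_mul hV2sa)
  have hG1sa : IsSemialgebraicFunOn ℚ C G1 := by rw [hG1]; exact (hM1sa.fun_mul hA2sa).fun_neg
  have hD1sa : IsSemialgebraicFunOn ℚ C D1 := by rw [hD1]; exact (hV1sa.fun_mul hA2sa).fun_neg
  have hG2sa : IsSemialgebraicFunOn ℚ C G2 := by rw [hG2]; exact (hA1sa.fun_mul hM2sa).fun_neg
  have hD2sa : IsSemialgebraicFunOn ℚ C D2 := by rw [hD2]; exact (hA1sa.fun_mul hV2sa).fun_neg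
  have hG0c : ContinuousOn G0 C := by rw [hG0]; exact hA1c.mul hA2c
  have hD0c : ContinuousOn D0 C := by rw [hD0]; exact (hV1c.mul hA2c).add (hA1c.mul hV2c)
  have hG1c : ContinuousOn G1 C := by rw [hG1]; exact (hM1c.mul hA2c).neg
  have hD1c : ContinuousOn D1 C := by rw [hD1]; exact (hV1c.mul hA2c).neg
  have hG2c : ContinuousOn G2 C := by rw [hG2]; exact (hA1c.mul hM2c).neg
  have hD2c : ContinuousOn D2 C := by rw [hD2]; exact (hA1c.mul hV2c).neg
  -- composition with the (semialgebraic, continuous) face maps `x ↦ x[i ↦ t]`, `t ∈ {0, 1}`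
  have hface_sa : ∀ {F : (Fin 3 → ℝ) → ℝ}, IsSemialgebraicFunOn ℚ C F → ∀ (i : Fin 3) (t : ℝ), IsAlgebraic ℚ t →
      t ∈ Set.Icc (0:ℝ) 1 → IsSemialgebraicFunOn ℚ C (fun x => F (Function.update x i t)) :=
    fun hF i t ht htI => IsSemialgebraicFunOn.comp_isSemialgebraicMapOn_holds hF
      (isSemialgebraicMapOn_update_const i ht) fun x hx => hupd x hx i t htI
  have hface_c : ∀ {F : (Fin 3 → ℝ) → ℝ}, ContinuousOn F C → ∀ (i : Fin 3) (t : ℝ), t ∈ Set.Icc (0:ℝ) 1 →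
      ContinuousOn (fun x => F (Function.update x i t)) C :=
    fun hF i t htI => hF.comp (continuous_id.update i continuous_const).continuousOn fun x hx => hupd x hx i t htI
  have hcu : ∀ (x : Fin 3 → ℝ) (i : Fin 3), Continuous fun s : ℝ => Function.update x i s :=
    fun x i => continuous_const.update i continuous_id
  -- the three integrands and their representations on the cube
  obtain ⟨I0, hI0⟩ : ∃ I0 : (Fin 3 → ℝ) → ℝ, I0 = fun x =>
      D0 x - (G0 (Function.update x 2 1) - G0 (Function.update x 2 0)) := ⟨_, rfl⟩
  obtain ⟨I1, hI1⟩ : ∃ I1 : (Fin 3 → ℝ) → ℝ, I1 = fun x =>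
      D1 x - (G1 (Function.update x 0 1) - G1 (Function.update x 0 0)) := ⟨_, rfl⟩
  obtain ⟨I2, hI2⟩ : ∃ I2 : (Fin 3 → ℝ) → ℝ, I2 = fun x =>
      D2 x - (G2 (Function.update x 1 1) - G2 (Function.update x 1 0)) := ⟨_, rfl⟩
  have hI0sa : IsSemialgebraicFunOn ℚ C I0 := by
    rw [hI0]
    exact hD0sa.fun_sub ((hface_sa hG0sa 2 1 isAlgebraic_one h1I).fun_sub (hface_sa hG0sa 2 0 isAlgebraic_zero h0I))
  have hI1sa : IsSemialgebraicFunOn ℚ C I1 := by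
    rw [hI1]
    exact hD1sa.fun_sub ((hface_sa hG1sa 0 1 isAlgebraic_one h1I).fun_sub (hface_sa hG1sa 0 0 isAlgebraic_zero h0I))
  have hI2sa : IsSemialgebraicFunOn ℚ C I2 := by
    rw [hI2]
    exact hD2sa.fun_sub ((hface_sa hG2sa 1 1 isAlgebraic_one h1I).fun_sub (hface_sa hG2sa 1 0 isAlgebraic_zero h0I))
  have hI0c : ContinuousOn I0 C := by
    rw [hI0]; exact hD0c.sub ((hface_c hG0c 2 1 h1I).sub (hface_c hG0c 2 0 h0I))
  have hI1c : ContinuousOn I1 C := by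
    rw [hI1]; exact hD1c.sub ((hface_c hG1c 0 1 h1I).sub (hface_c hG1c 0 0 h0I))
  have hI2c : ContinuousOn I2 C := by
    rw [hI2]; exact hD2c.sub ((hface_c hG2c 1 1 h1I).sub (hface_c hG2c 1 0 h0I))
  obtain ⟨q0, hq0d, hq0i⟩ := exists_cubeRep 3 I0 hI0sa hI0c
  obtain ⟨q1, hq1d, hq1i⟩ := exists_cubeRep 3 I1 hI1sa hI1c
  obtain ⟨q2, hq2d, hq2i⟩ := exists_cubeRep 3 I2 hI2sa hI2c
  -- bounds
  have hbound : ∀ {F : (Fin 3 → ℝ) → ℝ}, ContinuousOn F C → ∃ B : ℝ, ∀ x ∈ C, |F x| ≤ B := fun hF => by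
    obtain ⟨B, hB⟩ := hCc.exists_bound_of_continuousOn hF
    exact ⟨B, fun x hx => by simpa [Real.norm_eq_abs] using hB x hx⟩
  -- assemble the three elements
  have hdec : FibStokesDecomposable 3
      (fun x => ∑ j, ((![q0, q1, q2] : Fin 3 → IntegralRep 3) j).integrand x) := by
    refine fibStokesDecomposable_of_elements (M := 3) (J := 3) (![2, 0, 1] : Fin 3 → Fin 3)
      (![G0, G1, G2] : Fin 3 → (Fin 3 → ℝ) → ℝ) (![D0, D1, D2] : Fin 3 → (Fin 3 → ℝ) → ℝ)
      (![q0, q1, q2] : Fin 3 → IntegralRep 3) ?_ ?_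
    · refine Fin.forall_fin_succ.mpr ⟨?_, Fin.forall_fin_two.mpr ⟨?_, ?_⟩⟩
      · -- element 0, along `v = x 2`
        simp only [Matrix.cons_val_zero]
        refine ⟨hG0sa, hD0sa, hbound hG0c, fun x hx => ?_, fun x hx hx2' => ?_⟩
        · show ContinuousOn (fun s : ℝ => G0 (Function.update x 2 s)) (Set.Icc (0:ℝ) 1)
          exact hG0c.comp (hcu x 2).continuousOn fun s hs => hupd x hx 2 s hs
        · show HasDerivAt (fun s : ℝ => G0 (Function.update x 2 s)) (D0 x) (x 2)
          have hfun : (fun s : ℝ => G0 (Function.update x 2 s)) = fun s => ℓ₁ (x 0) s * ℓ₂ (x 1) s := by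
            funext s; rw [hG0]
            simp only [Function.update_self, Function.update_of_ne h02, Function.update_of_ne h12]
          rw [hfun, hD0]
          exact (hdv₁ (x 0) (hmem x hx 0) (x 2) hx2').mul (hdv₂ (x 1) (hmem x hx 1) (x 2) hx2')
      · -- element 1, along `s = x 0`
        simp only [Fin.succ_zero_eq_one, Matrix.cons_val_one, Matrix.cons_val_zero]
        refine ⟨hG1sa, hD1sa, hbound hG1c, fun x hx => ?_, fun x hx hx0' => ?_⟩
        · show ContinuousOn (fun s : ℝ => G1 (Function.update x 0 s)) (Set.Icc (0:ℝ) 1)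
          exact hG1c.comp (hcu x 0).continuousOn fun s hs => hupd x hx 0 s hs
        · show HasDerivAt (fun s : ℝ => G1 (Function.update x 0 s)) (D1 x) (x 0)
          have hfun : (fun s : ℝ => G1 (Function.update x 0 s)) = fun s => -(μ₁ s (x 2) * ℓ₂ (x 1) (x 2)) := by
            funext s; rw [hG1]
            simp only [Function.update_self, Function.update_of_ne h10, Function.update_of_ne h20]
          rw [hfun, hD1]
          exact ((hds₁ (x 2) (hmem x hx 2) (x 0) hx0').mul_const (ℓ₂ (x 1) (x 2))).neg
      · -- element 2, along `t = x 1`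
        simp only [Fin.succ_one_eq_two, Matrix.cons_val_two, Matrix.tail_cons, Matrix.head_cons]
        refine ⟨hG2sa, hD2sa, hbound hG2c, fun x hx => ?_, fun x hx hx1' => ?_⟩
        · show ContinuousOn (fun s : ℝ => G2 (Function.update x 1 s)) (Set.Icc (0:ℝ) 1)
          exact hG2c.comp (hcu x 1).continuousOn fun s hs => hupd x hx 1 s hs
        · show HasDerivAt (fun s : ℝ => G2 (Function.update x 1 s)) (D2 x) (x 1)
          have hfun : (fun s : ℝ => G2 (Function.update x 1 s)) = fun s => -(ℓ₁ (x 0) (x 2) * μ₂ s (x 2)) := by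
            funext s; rw [hG2]
            simp only [Function.update_self, Function.update_of_ne h01, Function.update_of_ne h21]
          rw [hfun, hD2]
          exact ((hds₂ (x 2) (hmem x hx 2) (x 1) hx1').const_mul (ℓ₁ (x 0) (x 2))).neg
    · refine Fin.forall_fin_succ.mpr ⟨?_, Fin.forall_fin_two.mpr ⟨?_, ?_⟩⟩
      · simp only [Matrix.cons_val_zero]
        exact ⟨hq0d, fun x _ => by rw [hq0i, hI0]⟩
      · simp only [Fin.succ_zero_eq_one, Matrix.cons_val_one, Matrix.cons_val_zero]
        exact ⟨hq1d, fun x _ => by rw [hq1i, hI1]⟩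
      · simp only [Fin.succ_one_eq_two, Matrix.cons_val_two, Matrix.tail_cons, Matrix.head_cons]
        exact ⟨hq2d, fun x _ => by rw [hq2i, hI2]⟩
  -- the pointwise identity on the cube
  refine fibStokesDecomposable_congr_off_null 3 _ _ ∅
    Literature.ModelTheory.ExponentialFields.isSemialgebraic_empty measure_empty (fun x hx _ => ?_) hdec
  have hface0 : G0 (Function.update x 2 1) - G0 (Function.update x 2 0) =
      ℓ₁ (x 0) 1 * ℓ₂ (x 1) 1 - ℓ₁ (x 0) 0 * ℓ₂ (x 1) 0 := by
    rw [hG0]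
    simp only [Function.update_self, Function.update_of_ne h02, Function.update_of_ne h12]
  have hface1 : G1 (Function.update x 0 1) - G1 (Function.update x 0 0) = -(μ₁ 1 (x 2) * ℓ₂ (x 1) (x 2)) := by
    rw [hG1]
    simp only [Function.update_self, Function.update_of_ne h10, Function.update_of_ne h20, hμ₁0 (x 2) (hmem x hx 2),
      zero_mul, neg_zero, sub_zero]
  have hface2 : G2 (Function.update x 1 1) - G2 (Function.update x 1 0) = -(ℓ₁ (x 0) (x 2) * μ₂ 1 (x 2)) := by
    rw [hG2]
    simp only [Function.update_self, Function.update_of_ne h01, Function.update_of_ne h21, hμ₂0 (x 2) (hmem x hx 2),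
      mul_zero, neg_zero, sub_zero]
  simp only [Fin.sum_univ_three, Matrix.cons_val_zero, Matrix.cons_val_one, Matrix.cons_val_two, Matrix.tail_cons,
    Matrix.head_cons, hq0i, hq1i, hq2i, hI0, hI1, hI2, hface0, hface1, hface2, hD0, hD1, hD2]
  ring

end Summit.KontsevichZagierPeriods.KontsevichZagierPeriods.Cruxes.StokesGeneration.FibrewiseStokes

end
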